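import Literature.NumberTheory.Automorphic.AdeleQuotientFourierSummable
import Literature.NumberTheory.Automorphic.CuspFormsRapidDecayUnipotentArch
import Literature.NumberTheory.Automorphic.CuspFormsRapidDecayLevel
import Literature.NumberTheory.Automorphic.CuspConditionGLLieDeriv
import Literature.NumberTheory.Automorphic.AutomorphicFormsGLContinuous
import Literature.NumberTheory.Automorphic.CuspFormFourierExpansionGL2Inputs
import HarnessLib

/-!
# Smooth automorphic functions on `GL₂(𝔸_K)` have absolutely summable Fourier coefficients along `N₂`
(the analytic step of the Fourier–Whittaker expansion of cusp forms, Cogdell (2004), §1.1, Thm. 1.1,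
for `n = 2`)

Topic `NumberTheory/Automorphic`; namespace `Literature.NumberTheory.Automorphic`. For a function
`φ : GL₂(𝔸_K) → ℂ` which is left `GL₂(K)`-invariant, smooth in the archimedean variable
(`IsArchSmooth (glArch 2 K)`) and right invariant under an admissible level `U ∈ finiteLevelsGL 2 K`
— e.g. an automorphic form for the honest datum `AutomorphyDatum.gl 2 K hcpt` — and `g ∈ GL₂(𝔸_K)`,
the continuous function `Φ_g : x + K ↦ φ(n(x) g)` on `𝔸_K ⧸ K` (`unipotentPeriodization`,
`WhittakerBesselGL2`) satisfies the hypotheses of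
`AdeleQuotientFourierSummable.summable_norm_integral_conj_adeleQuotChar_mul`:

* **finite level** (`exists_int_forall_apply_unipotentGL2_add_levelStep_mul`,
  `exists_int_forall_unipotentPeriodization_add_eq`):
  there is `c ∈ 𝓞_K ∖ 0` with `φ(n(x + (0, (c r)_f)) g) = φ(n(x) g)` for all `r ∈ 𝓞_K` — the unipotent
  `n((0, (c r)_f))` is a finite `c`-divisible integral block step, and `g⁻¹ n((0,(c r)_f)) g ∈ U`
  (`exists_int_forall_apply_unipotentOfBlock_mul_eq` of `CuspFormsRapidDecayLevel`); on `𝔸_K ⧸ K` this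
  is invariance of `Φ_g` under the archimedean lattice translations `((c r)_∞, 0) + K`;
* **archimedean derivative chains** (`hasDerivAt_unipotentPeriodization_blockDerivChain`): along the
  line `s ↦ u + (s v, 0) + K` the functions `Φ_g^{(j)} = ` periodisation of the iterated Lie
  derivative `X'^j φ`, `X' = Ad(g_∞⁻¹)(0 v; 0 0)` (`blockDerivChain 2 1 K φ g b j` of
  `CuspFormsRapidDecayUnipotentArch`, which does not change under `g ↦ n(x) g`,
  `twistedBlockDir_unipotentOfBlock_mul`), form a chain of `s`-derivatives
  (`IsArchSmooth.hasDerivAt_blockDerivChain`), each continuous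
  (`continuous_of_isArchSmooth_of_isRightInvariantUnder`).

Hence (`summable_norm_integral_conj_adeleQuotChar_mul_unipotentPeriodization`)
**`∑_{ξ ∈ K} |Φ̂_g(ξ)| < ∞`**, where for `ξ ≠ 0` the coefficient `Φ̂_g(ξ)` is the global Whittaker
coefficient `W_φ(d(ξ) g)` (`integral_conj_adeleQuotChar_mul_unipotentPeriodization` of
`WhittakerBesselGL2`). Everything here is proved.

## References

* J. W. Cogdell, *Analytic theory of L-functions for GL_n*, in: J. Bernstein, S. Gelbart (eds.),
  *An Introduction to the Langlands Program* (2004), §1.1, Thm. 1.1 (PDF p. 176 of the held copy)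
  [CogdellAnalyticTheory2004].
* C. Moeglin, J.-L. Waldspurger, *Spectral decomposition and Eisenstein series* (1995), proof of
  Lemma I.2.10 [MoeglinWaldspurger1995].
-/

-- Mathlib idiom (Mathlib/Algebra/Lie/OfAssociative.lean); needed to mention Lie subalgebras of matrix algebras
attribute [local instance 100] LieRing.ofAssociativeRing

noncomputable section

open _root_.MeasureTheory Set Filter IsDedekindDomain NumberField Matrix
open NumberField.mixedEmbedding NumberField.InfinitePlace
open _root_.Topology
open scoped MatrixGroups ENNReal ComplexConjugate Classical

namespace Literature.NumberTheory.Automorphic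

/-! ### Block unipotents of `GL_n`: the twisted direction does not see unipotent left factors -/

section Twist

variable {n k : ℕ} {K : Type} [Field K] [NumberField K]

/-- **The archimedean component of a block unipotent** `1 + P ∈ GL_n(𝔸_K)` is the unit `1 + P_∞`
(`unitOneAddBlock`). [folklore] -/
theorem toMixed_unipotentOfBlock (P : blockNilpotent n k (AdeleRing (𝓞 K) K)) :
    GLn.toMixed n K (unipotentOfBlock n k (AdeleRing (𝓞 K) K) (Multiplicative.ofAdd P)) =
      unitOneAddBlock P := by
  refine Units.ext (Matrix.ext fun i j => ?_)
  change InfiniteAdeleRing.ringEquiv_mixedSpace K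
    ((((1 : Matrix (Fin n) (Fin n) (AdeleRing (𝓞 K) K)) +
      (P : Matrix (Fin n) (Fin n) (AdeleRing (𝓞 K) K))) i j).1) = _
  rw [coe_unitOneAddBlock, Matrix.add_apply, Matrix.add_apply, blockArchMatrix_apply]
  change InfiniteAdeleRing.ringEquiv_mixedSpace K
    (((1 : Matrix (Fin n) (Fin n) (AdeleRing (𝓞 K) K)) i j).1 +
      (((P : Matrix (Fin n) (Fin n) (AdeleRing (𝓞 K) K))) i j).1) = _
  rw [map_add, fst_one_apply, Matrix.one_apply, Matrix.one_apply]
  split_ifs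
  · rw [map_one]
  · rw [map_zero]

/-- **The twisted direction `X' = Ad(g_∞⁻¹) B` does not see unipotent left factors of the same
block**: `twistedBlockDir ((1 + P) g) b = twistedBlockDir g b` for `P ∈ 𝔫_k(𝔸_K)`, because
`(1 + P_∞)⁻¹ B (1 + P_∞) = (1 - P_∞) B (1 + P_∞) = B` (`𝔫_k² = 0`: `P_∞ B = B P_∞ = 0`). [folklore] -/
theorem twistedBlockDir_unipotentOfBlock_mul (P : blockNilpotent n k (AdeleRing (𝓞 K) K))
    (g : GL (Fin n) (AdeleRing (𝓞 K) K)) (b : ArchBlockSpace n k K) :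
    twistedBlockDir n k K (unipotentOfBlock n k (AdeleRing (𝓞 K) K) (Multiplicative.ofAdd P) * g) b =
      twistedBlockDir n k K g b := by
  have hQB : blockArchMatrix n k K P * blockMatrixOf n k K b = 0 := by
    rw [← blockMatrixOf_archCoords, blockMatrixOf_mul_blockMatrixOf]
  have hBQ : blockMatrixOf n k K b * blockArchMatrix n k K P = 0 := by
    rw [← blockMatrixOf_archCoords, blockMatrixOf_mul_blockMatrixOf]
  have hinv : (((unitOneAddBlock P)⁻¹ : GL (Fin n) (mixedSpace K)) : Matrix (Fin n) (Fin n) (mixedSpace K)) =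
      1 - blockArchMatrix n k K P := rfl
  have key : (((unitOneAddBlock P)⁻¹ : GL (Fin n) (mixedSpace K)) : Matrix (Fin n) (Fin n) (mixedSpace K)) *
      (blockMatrixOf n k K b * ((unitOneAddBlock P : GL (Fin n) (mixedSpace K)) :
        Matrix (Fin n) (Fin n) (mixedSpace K))) = blockMatrixOf n k K b := by
    rw [hinv, coe_unitOneAddBlock, mul_add, mul_one, hBQ, add_zero, sub_mul, one_mul, hQB, sub_zero]
  have keyR : ∀ M : Matrix (Fin n) (Fin n) (mixedSpace K),
      (((unitOneAddBlock P)⁻¹ : GL (Fin n) (mixedSpace K)) : Matrix (Fin n) (Fin n) (mixedSpace K)) *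
        (blockMatrixOf n k K b * (((unitOneAddBlock P : GL (Fin n) (mixedSpace K)) :
          Matrix (Fin n) (Fin n) (mixedSpace K)) * M)) = blockMatrixOf n k K b * M := fun M => by
    rw [← Matrix.mul_assoc (blockMatrixOf n k K b), ← Matrix.mul_assoc, key]
  rw [twistedBlockDir, twistedBlockDir, map_mul, toMixed_unipotentOfBlock, _root_.mul_inv_rev,
    Units.val_mul, Units.val_mul]
  simp only [Matrix.mul_assoc]
  rw [keyR]

/-- Hence **the derivative chain along a block direction does not see unipotent left factors**:
`blockDerivChain φ ((1 + P) g) b j = blockDerivChain φ g b j`. [folklore] -/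
theorem blockDerivChain_unipotentOfBlock_mul (φ : GL (Fin n) (AdeleRing (𝓞 K) K) → ℂ)
    (P : blockNilpotent n k (AdeleRing (𝓞 K) K)) (g : GL (Fin n) (AdeleRing (𝓞 K) K))
    (b : ArchBlockSpace n k K) (j : ℕ) :
    blockDerivChain n k K φ (unipotentOfBlock n k (AdeleRing (𝓞 K) K) (Multiplicative.ofAdd P) * g) b j =
      blockDerivChain n k K φ g b j := by
  rw [blockDerivChain, blockDerivChain, twistedBlockDir_unipotentOfBlock_mul]

end Twist

/-! ### `N₂`: block unipotents, `n(x)`, and the archimedean line -/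

section Two

variable {K : Type} [Field K] [NumberField K]

/-- `1 + X = n(X₀₁)` for `X ∈ 𝔫₁(R)`, `n = 2`. [folklore] -/
theorem unipotentOfBlock_ofAdd_eq_unipotentGL2 {R : Type*} [CommRing R] (X : blockNilpotent 2 1 R) :
    unipotentOfBlock 2 1 R (Multiplicative.ofAdd X) =
      ((unipotentGL2 ((X : Matrix (Fin 2) (Fin 2) R) 0 1) : ↥(upperUnitriangular (Fin 2) R)) :
        GL (Fin 2) R) := by
  conv_lhs => rw [← blockOfEntryGL2_entry X]
  exact unipotentOfBlock_ofAdd_blockOfEntryGL2 _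

/-- **The archimedean block unipotent of `N₂` is `n((w, 0))`**: for `w ∈ K_∞ ≅ mixedSpace K`,
`archUnipotent 2 1 K (· ↦ w) = n((w, 0))` (`infiniteAdeleInl K`). [folklore] -/
theorem archUnipotent_two_one_eq (w : mixedSpace K) :
    archUnipotent 2 1 K (fun _ => w) =
      ((unipotentGL2 (infiniteAdeleInl K ((InfiniteAdeleRing.ringEquiv_mixedSpace K).symm w)) :
        ↥(adelicUnipotent 2 K)) : GL (Fin 2) (AdeleRing (𝓞 K) K)) := by
  rw [archUnipotent_def, glUnipotent_apply, unipotentOfBlock_ofAdd_eq_unipotentGL2]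
  have hent : ((archBlock 2 1 K (fun _ => w) : blockNilpotent 2 1 (AdeleRing (𝓞 K) K)) :
      Matrix (Fin 2) (Fin 2) (AdeleRing (𝓞 K) K)) 0 1 =
      infiniteAdeleInl K ((InfiniteAdeleRing.ringEquiv_mixedSpace K).symm w) := by
    refine Prod.ext ?_ ?_
    · rw [fst_archBlock_apply, blockMatrixOf_apply_of_mem _ ⟨Nat.zero_lt_one, le_refl 1⟩]
      rfl
    · rw [snd_archBlock_apply]
      rfl
  rw [hent]

/-- `n(x + y) g = n(y) (n(x) g)` (`N₂` is abelian). [folklore] -/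
theorem unipotentGL2_add_mul {R : Type*} [CommRing R] (x y : R) (g : GL (Fin 2) R) :
    ((unipotentGL2 (x + y) : ↥(upperUnitriangular (Fin 2) R)) : GL (Fin 2) R) * g =
      ((unipotentGL2 y : ↥(upperUnitriangular (Fin 2) R)) : GL (Fin 2) R) *
        (((unipotentGL2 x : ↥(upperUnitriangular (Fin 2) R)) : GL (Fin 2) R) * g) := by
  rw [add_comm, unipotentGL2_add, Subgroup.coe_mul, mul_assoc]

end Two

/-! ### Finite level: `Φ_g` is invariant under a lattice of translations -/

section Level

variable {K : Type} [Field K] [NumberField K]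

/-- The finite, `c`-divisible integral unipotent step `(0 z; 0 0)`, `z = (0, (c r)_f)`
(`z = c r - ((c r)_∞, 0)` as an adele), lies in `finIntegralBlock c`. [folklore] -/
theorem blockOfEntryGL2_levelStep_mem_finIntegralBlock (c r : 𝓞 K) :
    blockOfEntryGL2 (algebraMap K (AdeleRing (𝓞 K) K) ((c : K) * r) -
        infiniteAdeleInl K (algebraMap K (InfiniteAdeleRing K) ((c : K) * r))) ∈
      (finIntegralBlock c : AddSubgroup (blockNilpotent 2 1 (AdeleRing (𝓞 K) K))) := by
  set z : AdeleRing (𝓞 K) K := algebraMap K (AdeleRing (𝓞 K) K) ((c : K) * r) -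
    infiniteAdeleInl K (algebraMap K (InfiniteAdeleRing K) ((c : K) * r)) with hz
  have hz1 : z.1 = 0 := by
    rw [hz, AdeleRing.fst_sub, AdeleRing.algebraMap_fst]
    exact sub_self _
  have hz2 : z.2 = algebraMap (𝓞 K) (FiniteAdeleRing (𝓞 K) K) c *
      algebraMap K (FiniteAdeleRing (𝓞 K) K) (r : K) := by
    rw [hz, AdeleRing.snd_sub, AdeleRing.algebraMap_snd, map_mul,
      IsScalarTower.algebraMap_apply (𝓞 K) K (FiniteAdeleRing (𝓞 K) K) c]
    exact sub_zero _
  have hr : algebraMap K (FiniteAdeleRing (𝓞 K) K) (r : K) ∈ integralFiniteAdeles K :=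
    fun v => isFiniteIntegral_algebraMap_coe K r v
  refine ⟨fun i j => ?_, fun i j => ?_⟩
  · rw [coe_blockOfEntryGL2]
    fin_cases i <;> fin_cases j
    · rfl
    · exact hz1
    · rfl
    · rfl
  · rw [coe_blockOfEntryGL2]
    fin_cases i <;> fin_cases j
    · exact ⟨0, zero_mem _, by rw [mul_zero]; rfl⟩
    · exact ⟨_, hr, hz2⟩
    · exact ⟨0, zero_mem _, by rw [mul_zero]; rfl⟩
    · exact ⟨0, zero_mem _, by rw [mul_zero]; rfl⟩

/-- **Finite level: a lattice of finite unipotent steps drops out.** For `φ` right invariant under an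
admissible level `U` and `g ∈ GL₂(𝔸_K)` there is `c ∈ 𝓞_K ∖ 0` with
`φ(n(x + z_r) g) = φ(n(x) g)` for all `x ∈ 𝔸_K`, `r ∈ 𝓞_K`, `z_r = (0, (c r)_f)`
(`exists_int_forall_apply_unipotentOfBlock_mul_eq` at the compact set `{g}`). [folklore] -/
theorem exists_int_forall_apply_unipotentGL2_add_levelStep_mul
    {U : Subgroup (GL (Fin 2) (AdeleRing (𝓞 K) K))} (hU : U ∈ finiteLevelsGL 2 K)
    {φ : GL (Fin 2) (AdeleRing (𝓞 K) K) → ℂ} (hφU : IsRightInvariantUnder U φ)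
    (g : GL (Fin 2) (AdeleRing (𝓞 K) K)) :
    ∃ c : 𝓞 K, c ≠ 0 ∧ ∀ (r : 𝓞 K) (x : AdeleRing (𝓞 K) K),
      φ (((unipotentGL2 (x + (algebraMap K (AdeleRing (𝓞 K) K) ((c : K) * r) -
          infiniteAdeleInl K (algebraMap K (InfiniteAdeleRing K) ((c : K) * r)))) :
            ↥(adelicUnipotent 2 K)) : GL (Fin 2) (AdeleRing (𝓞 K) K)) * g) =
        φ (((unipotentGL2 x : ↥(adelicUnipotent 2 K)) : GL (Fin 2) (AdeleRing (𝓞 K) K)) * g) := by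
  obtain ⟨c, hc0, hc⟩ := exists_int_forall_apply_unipotentOfBlock_mul_eq hU hφU
    (isCompact_singleton (x := g))
  refine ⟨c, hc0, fun r x => ?_⟩
  have h := hc 1 _ (blockOfEntryGL2_levelStep_mem_finIntegralBlock c r) g (mem_singleton g) 1
    ((unipotentGL2 x : ↥(adelicUnipotent 2 K)) : GL (Fin 2) (AdeleRing (𝓞 K) K))
  rw [map_one, one_mul, unipotentOfBlock_ofAdd_blockOfEntryGL2, ← Subgroup.coe_mul,
    ← unipotentGL2_add] at h
  exact h

/-- **On `𝔸_K ⧸ K`, finite level is invariance under an archimedean lattice**: for `φ` left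
`GL₂(K)`-invariant and right invariant under an admissible level, and `g ∈ GL₂(𝔸_K)`, there is
`c ∈ 𝓞_K ∖ 0` such that `Φ_g(u + ((c r)_∞, 0) + K) = Φ_g(u)` for all `r ∈ 𝓞_K`
(`((c r)_∞, 0) ≡ -(0, (c r)_f) mod K`). [folklore] -/
theorem exists_int_forall_unipotentPeriodization_add_eq
    {φ : GL (Fin 2) (AdeleRing (𝓞 K) K) → ℂ} (hφ : IsLeftInvariant (AdelicGroupData.gl 2 K) φ)
    {U : Subgroup (GL (Fin 2) (AdeleRing (𝓞 K) K))} (hU : U ∈ finiteLevelsGL 2 K)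
    (hφU : IsRightInvariantUnder U φ) (g : GL (Fin 2) (AdeleRing (𝓞 K) K)) :
    ∃ c : 𝓞 K, c ≠ 0 ∧ ∀ (r : 𝓞 K) (u : adeleQuotient K),
      unipotentPeriodization hφ g (u + QuotientAddGroup.mk
        (infiniteAdeleInl K (algebraMap K (InfiniteAdeleRing K) ((c : K) * r)))) =
      unipotentPeriodization hφ g u := by
  obtain ⟨c, hc0, hc⟩ := exists_int_forall_apply_unipotentGL2_add_levelStep_mul hU hφU g
  refine ⟨c, hc0, fun r u => ?_⟩
  obtain ⟨x, rfl⟩ := QuotientAddGroup.mk_surjective u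
  set z : AdeleRing (𝓞 K) K := algebraMap K (AdeleRing (𝓞 K) K) ((c : K) * r) -
    infiniteAdeleInl K (algebraMap K (InfiniteAdeleRing K) ((c : K) * r)) with hz
  have hsplit : x + infiniteAdeleInl K (algebraMap K (InfiniteAdeleRing K) ((c : K) * r)) =
      algebraMap K (AdeleRing (𝓞 K) K) ((c : K) * r) + (x - z) := by
    rw [hz]; abel
  rw [← QuotientAddGroup.mk_add, unipotentPeriodization_mk, unipotentPeriodization_mk, hsplit,
    apply_unipotentGL2_algebraMap_add_mul hφ, ← hc r (x - z), sub_add_cancel]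

end Level

/-! ### Archimedean smoothness: derivative chains of `Φ_g` along archimedean lines -/

section Arch

variable {K : Type} [Field K] [NumberField K]

/-- The iterated Lie derivatives `X'^j φ` along a block direction are left `GL_n(K)`-invariant
with `φ`. [folklore] -/
theorem isLeftInvariant_blockDerivChain {n k : ℕ} {φ : GL (Fin n) (AdeleRing (𝓞 K) K) → ℂ}
    (hφ : IsLeftInvariant (AdelicGroupData.gl n K) φ) (g : GL (Fin n) (AdeleRing (𝓞 K) K))
    (b : ArchBlockSpace n k K) (j : ℕ) :
    IsLeftInvariant (AdelicGroupData.gl n K) (blockDerivChain n k K φ g b j) :=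
  IsLeftInvariantUnder.iterLieDeriv_gl (V := (AdelicGroupData.gl n K).arithmeticSubgroup) hφ _

/-- The iterated Lie derivatives `X'^j φ` along a block direction are right invariant under an
admissible level with `φ`. [folklore] -/
theorem isRightInvariantUnder_blockDerivChain {n k : ℕ} {φ : GL (Fin n) (AdeleRing (𝓞 K) K) → ℂ}
    {U : Subgroup (GL (Fin n) (AdeleRing (𝓞 K) K))} (hU : U ∈ finiteLevelsGL n K)
    (hφU : IsRightInvariantUnder U φ) (g : GL (Fin n) (AdeleRing (𝓞 K) K))
    (b : ArchBlockSpace n k K) (j : ℕ) :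
    IsRightInvariantUnder U (blockDerivChain n k K φ g b j) :=
  hφU.iterLieDeriv_gl hU _

/-- The iterated Lie derivatives `X'^j φ` of a level-invariant archimedean-smooth `φ` are
continuous on `GL_n(𝔸_K)`. [folklore] -/
theorem continuous_blockDerivChain {n k : ℕ} {φ : GL (Fin n) (AdeleRing (𝓞 K) K) → ℂ}
    (hs : IsArchSmooth (glArch n K) φ) {U : Subgroup (GL (Fin n) (AdeleRing (𝓞 K) K))}
    (hU : U ∈ finiteLevelsGL n K) (hφU : IsRightInvariantUnder U φ)
    (g : GL (Fin n) (AdeleRing (𝓞 K) K)) (b : ArchBlockSpace n k K) (j : ℕ) :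
    Continuous (blockDerivChain n k K φ g b j) :=
  continuous_of_isArchSmooth_of_isRightInvariantUnder (isArchSmooth_blockDerivChain hs g b j) hU
    (isRightInvariantUnder_blockDerivChain hU hφU g b j)

/-- **The derivative chain of `Φ_g` along an archimedean line.** For `φ` left `GL₂(K)`-invariant
and smooth in the archimedean variable, `v ∈ K_∞ ≅ mixedSpace K`, `b = (· ↦ v)` the block
direction of `N₂` and `j ∈ ℕ`, the periodisations `Φ_g^{(j)} : x + K ↦ (X'^j φ)(n(x) g)` of the
iterated Lie derivatives `X'^j φ = blockDerivChain 2 1 K φ g b j` satisfy: `s ↦ Φ_g^{(j)}(u + (s v, 0))`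
has derivative `Φ_g^{(j+1)}(u + (s v, 0))` at every `s` — since `n(x + (s v, 0)) g = (1 + s b) (n(x) g)`
(`archUnipotent_two_one_eq`) and `X'` is the same at `n(x) g` and at `g`
(`blockDerivChain_unipotentOfBlock_mul`), this is `IsArchSmooth.hasDerivAt_blockDerivChain`.
[cite: CogdellAnalyticTheory2004, §1.1] -/
theorem hasDerivAt_unipotentPeriodization_blockDerivChain
    {φ : GL (Fin 2) (AdeleRing (𝓞 K) K) → ℂ} (hφ : IsLeftInvariant (AdelicGroupData.gl 2 K) φ)
    (hs : IsArchSmooth (glArch 2 K) φ) (g : GL (Fin 2) (AdeleRing (𝓞 K) K)) (v : mixedSpace K)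
    (j : ℕ) (u : adeleQuotient K) (s : ℝ) :
    HasDerivAt (fun s : ℝ => unipotentPeriodization
        (isLeftInvariant_blockDerivChain hφ g (fun _ : BlockPos 2 1 => v) j) g
        (u + QuotientAddGroup.mk
          (infiniteAdeleInl K ((InfiniteAdeleRing.ringEquiv_mixedSpace K).symm (s • v)))))
      (unipotentPeriodization
        (isLeftInvariant_blockDerivChain hφ g (fun _ : BlockPos 2 1 => v) (j + 1)) g
        (u + QuotientAddGroup.mk
          (infiniteAdeleInl K ((InfiniteAdeleRing.ringEquiv_mixedSpace K).symm (s • v))))) s := by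
  obtain ⟨x, rfl⟩ := QuotientAddGroup.mk_surjective u
  set b : ArchBlockSpace 2 1 K := fun _ => v with hb
  set g' : GL (Fin 2) (AdeleRing (𝓞 K) K) :=
    ((unipotentGL2 x : ↥(adelicUnipotent 2 K)) : GL (Fin 2) (AdeleRing (𝓞 K) K)) * g with hg'
  -- `n(x + (s v, 0)) g = (1 + s b) (n(x) g)`
  have hline : ∀ s : ℝ, ((unipotentGL2 (x + infiniteAdeleInl K
      ((InfiniteAdeleRing.ringEquiv_mixedSpace K).symm (s • v))) : ↥(adelicUnipotent 2 K)) :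
        GL (Fin 2) (AdeleRing (𝓞 K) K)) * g = archUnipotent 2 1 K (0 + s • b) * g' := fun s => by
    rw [unipotentGL2_add_mul, zero_add, hg', hb]
    congr 1
    exact (archUnipotent_two_one_eq (s • v)).symm
  -- the chain does not see the base point change `g ↦ n(x) g`
  have hchain : ∀ i, blockDerivChain 2 1 K φ g' b i = blockDerivChain 2 1 K φ g b i := fun i => by
    rw [hg', ← unipotentOfBlock_ofAdd_blockOfEntryGL2]
    exact blockDerivChain_unipotentOfBlock_mul φ _ g b i
  have hfun : ∀ i, (fun s : ℝ => unipotentPeriodization (isLeftInvariant_blockDerivChain hφ g b i) g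
      ((QuotientAddGroup.mk x : adeleQuotient K) + QuotientAddGroup.mk
        (infiniteAdeleInl K ((InfiniteAdeleRing.ringEquiv_mixedSpace K).symm (s • v))))) =
      fun s : ℝ => blockDerivChain 2 1 K φ g' b i (archUnipotent 2 1 K (0 + s • b) * g') := by
    intro i
    funext s
    rw [← QuotientAddGroup.mk_add, unipotentPeriodization_mk, hline s, hchain i]
  have hval : unipotentPeriodization (isLeftInvariant_blockDerivChain hφ g b (j + 1)) g
      ((QuotientAddGroup.mk x : adeleQuotient K) + QuotientAddGroup.mk
        (infiniteAdeleInl K ((InfiniteAdeleRing.ringEquiv_mixedSpace K).symm (s • v)))) =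
      blockDerivChain 2 1 K φ g' b (j + 1) (archUnipotent 2 1 K (0 + s • b) * g') :=
    congrFun (hfun (j + 1)) s
  rw [hfun j, hval]
  exact hs.hasDerivAt_blockDerivChain g' 0 b j s

end Arch

/-! ### Absolute summability of the Fourier coefficients of `Φ_g` -/

section Summable

variable {K : Type} [Field K] [NumberField K]
  [MeasurableSpace (adeleQuotient K)] [BorelSpace (adeleQuotient K)]

/-- **Smooth automorphic functions on `GL₂(𝔸_K)` have absolutely summable Fourier coefficients
along `N₂`.** Let `φ : GL₂(𝔸_K) → ℂ` be left `GL₂(K)`-invariant, smooth in the archimedean variable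
and right invariant under an admissible level `U ∈ finiteLevelsGL 2 K`. Then for every `g`, the
Fourier coefficients `Φ̂_g(ξ) = ∫ conj ψ_ξ · Φ_g` of `Φ_g : x + K ↦ φ(n(x) g)` satisfy
`∑_{ξ ∈ K} |Φ̂_g(ξ)| < ∞` (`summable_norm_integral_conj_adeleQuotChar_mul` with the finite-level
invariance `exists_int_forall_unipotentPeriodization_add_eq` and the archimedean derivative chains
`hasDerivAt_unipotentPeriodization_blockDerivChain` of length `[K : ℚ] + 1`). This is the absolute
convergence in the Fourier–Whittaker expansion of `GL₂` cusp forms (Cogdell (2004), Thm. 1.1,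
`n = 2`). [cite: CogdellAnalyticTheory2004, Thm. 1.1] -/
theorem summable_norm_integral_conj_adeleQuotChar_mul_unipotentPeriodization
    {φ : GL (Fin 2) (AdeleRing (𝓞 K) K) → ℂ} (hφ : IsLeftInvariant (AdelicGroupData.gl 2 K) φ)
    (hs : IsArchSmooth (glArch 2 K) φ) {U : Subgroup (GL (Fin 2) (AdeleRing (𝓞 K) K))}
    (hU : U ∈ finiteLevelsGL 2 K) (hφU : IsRightInvariantUnder U φ)
    (g : GL (Fin 2) (AdeleRing (𝓞 K) K)) :
    Summable fun ξ : K => ‖∫ u, conj (adeleQuotChar K ξ u : ℂ) *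
      unipotentPeriodization hφ g u ∂(adeleQuotHaar K)‖ := by
  obtain ⟨c, hc0, hc⟩ := exists_int_forall_unipotentPeriodization_add_eq hφ hU hφU g
  refine summable_norm_integral_conj_adeleQuotChar_mul K hc0 hc
    (k := Module.finrank ℚ K + 1) (Nat.lt_succ_self _) fun v => ?_
  refine ⟨fun j => unipotentPeriodization
    (isLeftInvariant_blockDerivChain hφ g (fun _ : BlockPos 2 1 => v) j) g, rfl,
    fun j _ => continuous_unipotentPeriodization _
      (continuous_blockDerivChain hs hU hφU g _ j) g,
    fun j _ u s => hasDerivAt_unipotentPeriodization_blockDerivChain hφ hs g v j u s⟩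

end Summable

end Literature.NumberTheory.Automorphic
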